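import Summits.BirchSwinnertonDyer.BirchSwinnertonDyer.Theorems.ManinLocalTwoThreeQuarterEighthTranslate
import Summits.BirchSwinnertonDyer.BirchSwinnertonDyer.Theorems.ManinLocalTwoThreeLineIndexTwistInvariance
import Summits.BirchSwinnertonDyer.Rank1Residual.ManinAdditive.NeronConwayTw
import Summits.BirchSwinnertonDyer.Rank1Residual.ManinAdditive.CharTwistTwoIsometry
import HarnessLib

/-!
# imc's twist component `Tw = (t_{1/4} − t_{3/4})/(2i)` IS the character twist by `χ₋₄` (`16 ∣ N`): bridge to the O5 /
# `TwistAtTwo` machinery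

Summit `BirchSwinnertonDyer`, sub-problem `BirchSwinnertonDyer`, route `ManinLocalTwoThree`; width seat `bsd-line-manin23-p2`
(gen 9), `--supports` the crux C2 `ManinOddAtFour` (stmt-BirchSwinnertonDyer-22967).  Cell `bsd-f2-manin`, imc g18 leaf
`…ManinAdditive.NeronConwayTw` (`twistOperatorAtTwo`, laws E-imc-136 `TwistExponentLaw`, E-imc-137 `TwistRamanujanCoincidence`;
REF1 A81.2: «`Tw` has `q`-action `χ₋₄(n) aₙ`»).  With the seat's `cuspCoeff_quarterTranslate_two` (p652148) this becomes a
KERNEL identity of operators: `Tw x = charTwist N _ _ χ x` for the primitive quadratic `χ` mod `4`, so everything the tree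
knows about `charTwist` at conductor `4` (integrality `TwistAtTwo.charTwist_mem_integralCuspForms0`, the Petersson isometry
`TwistAtTwo.peterssonProduct_charTwist_charTwist_four`, TWIN `TwistAtTwo.congruenceNumber_charTwist_four…`, the seat's
`lineIndex_charTwist_four`) applies verbatim to imc's `Tw`.

PROVED here (no `sorry`): `cuspCoeff_twistOperatorAtTwo_two` (`aₙ(Tw x) = ((iⁿ − (−i)ⁿ)/(2i))·aₙ(x)`),
`chi_four_natCast_eq` (`χ₋₄(n) = (iⁿ − (−i)ⁿ)/(2i)`), **`twistOperatorAtTwo_two_eq_charTwist`**,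
`twistOperatorAtTwo_mem_integralCuspForms0` (`Tw` preserves `S₂(Γ₀(N);ℤ)` — so the factor `2` in E-imc-136's «`2·Tw`» is not
needed for integrality, only for the Conway conditions), `lineIndex_twistOperatorAtTwo_eq` (`Tw`-stable lattice, `2`-depleted `f`).

Elementary.  BSD is not proved by this; Manin's conjecture is not proved by this.
-/

set_option autoImplicit false
set_option linter.dupNamespace false

noncomputable section

open scoped MatrixGroups ModularForm Real
open CongruenceSubgroup
open Literature.NumberTheory.EllipticCurves Literature.NumberTheory.EllipticCurves.ModularForms
open Summit.BirchSwinnertonDyer.Rank1Residual.ManinAdditive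
open Summit.BirchSwinnertonDyer.Rank1Residual.ManinAdditive.NeronConway
open Summit.BirchSwinnertonDyer.Rank1Residual.ManinAdditive.NeronConwayTw

namespace Summit.BirchSwinnertonDyer.BirchSwinnertonDyer.Theorems.ManinLocalTwoThree

variable {N : ℕ} [NeZero N]

/-- **`aₙ(Tw x) = ((iⁿ − (−i)ⁿ)/(2i)) · aₙ(x)`** (`16 ∣ N`, weight `2`). -/
theorem cuspCoeff_twistOperatorAtTwo_two (h16 : 16 ∣ N) (x : CuspForm (Gamma0 N) 2) (n : ℕ) :
    cuspCoeff (twistOperatorAtTwo N 2 x) n =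
      (2 * Complex.I)⁻¹ * (Complex.I ^ n - (-Complex.I) ^ n) * cuspCoeff x n := by
  rw [twistOperatorAtTwo_two_eq, LinearMap.smul_apply, LinearMap.sub_apply, cuspCoeff_smul_gamma0, cuspCoeff_sub_gamma0,
    cuspCoeff_quarterTranslate_two h16, cuspCoeff_quarterTranslate_two h16, cexp_two_pi_I_quarter,
    cexp_two_pi_I_three_quarter]
  ring

/-- **`χ₋₄(n) = (iⁿ − (−i)ⁿ)/(2i)`** for the primitive quadratic character mod `4`. -/
theorem chi_four_natCast_eq {χ : DirichletCharacter ℂ 4} (hχ : χ.IsQuadratic) (hprim : χ.IsPrimitive) (n : ℕ) :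
    χ n = (2 * Complex.I)⁻¹ * (Complex.I ^ n - (-Complex.I) ^ n) := by
  have hI2 : (2 * Complex.I) ≠ 0 := mul_ne_zero two_ne_zero Complex.I_ne_zero
  have h4 : Complex.I ^ 4 = 1 := Complex.I_pow_four
  have hmodI : Complex.I ^ n = Complex.I ^ (n % 4) := by
    conv_lhs => rw [← Nat.div_add_mod n 4, pow_add, pow_mul, h4, one_pow, one_mul]
  have h4' : (-Complex.I) ^ 4 = 1 := by rw [neg_pow, h4]; norm_num
  have hmodI' : (-Complex.I) ^ n = (-Complex.I) ^ (n % 4) := by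
    conv_lhs => rw [← Nat.div_add_mod n 4, pow_add, pow_mul, h4', one_pow, one_mul]
  have hχmod : χ (n : ZMod 4) = χ ((n % 4 : ℕ) : ZMod 4) := by rw [ZMod.natCast_mod]
  rw [hχmod, hmodI, hmodI']
  have hr : n % 4 = 0 ∨ n % 4 = 1 ∨ n % 4 = 2 ∨ n % 4 = 3 := by omega
  have hI3 : Complex.I ^ 3 = -Complex.I := by rw [pow_succ, Complex.I_sq]; ring
  rcases hr with hr | hr | hr | hr <;> rw [hr]
  · rw [TwistAtTwo.chi_natCast_eq_zero_of_two_dvd TwistAtTwo.isUnit_natCast_zmod_four_iff χ (by norm_num : 2 ∣ 0)]; simp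
  · rw [Nat.cast_one, map_one, pow_one, pow_one]; field_simp; ring
  · rw [TwistAtTwo.chi_natCast_eq_zero_of_two_dvd TwistAtTwo.isUnit_natCast_zmod_four_iff χ (by norm_num : 2 ∣ 2)]
    rw [neg_pow, Complex.I_sq]; norm_num
  · rw [show ((3 : ℕ) : ZMod 4) = 3 from rfl, TwistAtTwo.chi_four_apply_three hχ hprim, Odd.neg_pow (by decide : Odd 3), hI3]
    field_simp; ring

/-- **imc's `Tw` is the `χ₋₄`-twist**: `twistOperatorAtTwo N 2 x = charTwist N _ _ χ x` (`16 ∣ N`, `χ` the primitive quadratic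
character mod `4`). -/
theorem twistOperatorAtTwo_two_eq_charTwist (h16 : 4 ^ 2 ∣ N) {χ : DirichletCharacter ℂ 4} (hχ : χ.IsQuadratic)
    (hprim : χ.IsPrimitive) (x : CuspForm (Gamma0 N) 2) :
    twistOperatorAtTwo N 2 x = charTwist N dvd_rfl h16 hχ x := by
  refine eq_of_forall_cuspCoeff_eq_gamma0 fun n => ?_
  rw [cuspCoeff_twistOperatorAtTwo_two (by simpa using h16), cuspCoeff_charTwist (L := N) (hN := dvd_rfl) (hm := h16)
    (hχ := hχ) (hprim := hprim), chi_four_natCast_eq hχ hprim]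

/-- **`Tw` preserves `S₂(Γ₀(N); ℤ)`** (`16 ∣ N`). -/
theorem twistOperatorAtTwo_mem_integralCuspForms0 (h16 : 4 ^ 2 ∣ N) {χ : DirichletCharacter ℂ 4} (hχ : χ.IsQuadratic)
    (hprim : χ.IsPrimitive) {x : CuspForm (Gamma0 N) 2} (hx : x ∈ integralCuspForms0 N 2) :
    twistOperatorAtTwo N 2 x ∈ integralCuspForms0 N 2 := by
  rw [twistOperatorAtTwo_two_eq_charTwist h16 hχ hprim]
  exact TwistAtTwo.charTwist_mem_integralCuspForms0 h16 hχ hprim hx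

/-- **`Tw` preserves the `f`-line index of every `Tw`-stable `ℤ`-lattice** for `2`-depleted `f` (e.g. a newform at `4 ∣ N`):
`lineIndex M (Tw f) = lineIndex M f`. -/
theorem lineIndex_twistOperatorAtTwo_eq (h16 : 4 ^ 2 ∣ N) {χ : DirichletCharacter ℂ 4} (hχ : χ.IsQuadratic)
    (hprim : χ.IsPrimitive) {M : Submodule ℤ (CuspForm (Gamma0 N) 2)}
    (hM : ∀ x ∈ M, twistOperatorAtTwo N 2 x ∈ M) {f : CuspForm (Gamma0 N) 2} (hf : ∀ n, 2 ∣ n → cuspCoeff f n = 0) :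
    lineIndex M (twistOperatorAtTwo N 2 f) = lineIndex M f := by
  rw [twistOperatorAtTwo_two_eq_charTwist h16 hχ hprim]
  exact lineIndex_charTwist_four h16 hχ hprim
    (fun x hx => by rw [← twistOperatorAtTwo_two_eq_charTwist h16 hχ hprim]; exact hM x hx) hf

end Summit.BirchSwinnertonDyer.BirchSwinnertonDyer.Theorems.ManinLocalTwoThree

end
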